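import Summits.RiemannHypothesis.RiemannHypothesis.Theses.LiRephasingBarrier
import HarnessLib

/-!
# Route LiRephasingBarrier (L5 «LI REPHASING GAIN BUDGET») — `Assembly` (RH-FREE)

Item stmt-RiemannHypothesis-22319: `ScalePL → TheoremAInftyPL → RephasedLowPhaseLawFails`. The proof is the
`K_k := −k` bookkeeping of lane (xi-q) carve Q6 `rephasing_kills_lowPhaseLaw` (tree file
Theorems/Splittings/LiRephasingMovingCut.lean ll.238–264), exactly as kernel-checked by the planner
(rh-idea-3 g0, l5/Sketch2.lean sha16 cc98a8b5cdc3ed45, `assembly_holds`); `ScalePL` is curried through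
(it is the input of the schedule construction inside `TheoremAInftyPL`'s own proof).
RH-free barrier-side record (B18); no summit is proved by this; nothing here bears on the truth of RH.
-/

-- D-0017: `Summit.RiemannHypothesis.RiemannHypothesis.…` duplicates the namespace BY DESIGN (single-problem summit).
set_option linter.dupNamespace false

namespace Summit.RiemannHypothesis.RiemannHypothesis.Theorems.LiRephasingBarrier

/-- **`Assembly` (item stmt-RiemannHypothesis-22319) holds**: from `TheoremAInftyPL` with floors
`K_k := −k`, for every `K` and `n₀` pick `k = max n₀ ⌈−K⌉₊`; the block `[N_k, 2N_k)`, `N_k ≥ 260·4^k > k`,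
supplies `n ≥ n₀` with `lowSumRe glim n (√n log n) < −k − ½ log n ≤ K − ½ log n`; the `∀ᶠ` form follows.
(Planner rh-idea-3's kernel-checked `assembly_holds`, verbatim.) RH-free. -/
theorem assembly_proof :
    Summit.RiemannHypothesis.RiemannHypothesis.Theses.LiRephasingBarrier.Assembly := by
  intro _ hA mseq hm
  obtain ⟨S, h1, h2, h3, h4, h5, h6, h7⟩ := hA mseq hm (fun k ↦ -(k : ℝ))
  have key : ∀ K : ℝ, ∀ n₀ : ℕ, ∃ n ≥ n₀,
      Summit.RiemannHypothesis.RiemannHypothesis.Theorems.Splittings.LiRephasingGainBudget.lowSumRe S.glim n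
        (Real.sqrt n * Real.log n) < K - Real.log n / 2 := by
    intro K n₀
    set k := max n₀ ⌈-K⌉₊ with hk
    obtain ⟨n, hn, hlt⟩ := h7 k
    obtain ⟨hn1, -⟩ := Finset.mem_Ico.1 hn
    have hNk := h2 k
    have h4k : (k : ℝ) < 4 ^ k := by exact_mod_cast Nat.lt_pow_self (by norm_num : 1 < 4)
    have hkn : n₀ ≤ n := by
      have : (k : ℝ) ≤ n := by
        have : (S.N k : ℝ) ≤ n := by exact_mod_cast hn1
        linarith
      have hk0 : n₀ ≤ k := le_max_left _ _
      exact_mod_cast (show (n₀ : ℝ) ≤ n from le_trans (by exact_mod_cast hk0) this)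
    refine ⟨n, hkn, lt_of_lt_of_le hlt ?_⟩
    have : -K ≤ (k : ℝ) := (Nat.le_ceil (-K)).trans (by exact_mod_cast le_max_right _ _)
    linarith
  refine ⟨S, h1, h3, h4, h5, h6, key, fun K hK ↦ ?_⟩
  obtain ⟨n₀, hn₀⟩ := Filter.eventually_atTop.1 hK
  obtain ⟨n, hn, hlt⟩ := key K n₀
  exact absurd (hn₀ n hn) (not_le.2 hlt)

end Summit.RiemannHypothesis.RiemannHypothesis.Theorems.LiRephasingBarrier
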